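import Summits.HubbardSuperconductivity.HubbardSuperconductivity.Theses.LiebTwin
import Summits.HubbardSuperconductivity.HubbardSuperconductivity.Theorems.NoGoNogoThesis
import Literature.MathematicalPhysics.QuantumLattice.FreeFermionSectorGroundStates
import Literature.MathematicalPhysics.QuantumLattice.PatchPairOperator
import Literature.MathematicalPhysics.QuantumLattice.BdGBondHamiltonianTorus
import Literature.MathematicalPhysics.QuantumLattice.TorusCooperSum

/-!
# Crux `NoOnsiteODLRO` (stmt-HubbardSuperconductivity-0933; routes `LiebTwin`, `EnslavedA1g`) —
# negative-side support: the `L²` law is ATTAINED by exact ground states at the endpoint `U = 0`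

The crux asks `S_L := Re⟨ψ_L, P_sᴴ P_s ψ_L⟩ = o(L⁴)` for every admissible sector ground-state sequence of
the REPULSIVE torus (`U > 0`), `P_s = pairField sWave L`. This file records, kernel-checked, the tightness
anchor at the closed endpoint of the coupling range: at `U = 0` the paired Fermi seas
`Φ_F = Π_{k∈F} c†_{k↑} c†_{-k↓} |0⟩` (tree `FreeFermionSectorGroundStates`: exact ground states of the joint
sectors `(2|F|, S^z = 0)` for Fermi sets `F`) have `S_L = 2|F| = N_L` EXACTLY — every `(k↑, -k↓)` pair of
the sea is an on-site `k = 0` Cooper pair of amplitude `√2`, and the pair-removed seas are orthonormal.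

* `pairFieldMode_sWave`, `pairField_sWave_eq_neg_smul_sum_pairMode` — `P_s = -√2 Σ_k b_k` in Bloch modes
  (`b_k = c_{-k↓}c_{k↑}`; the `s`-wave profile of the tree's pair-field bridge is flat).
* `pairMode_pairedState_of_mem`, `star_pairedState_erase_dotProduct_erase` — `b_q Φ_l = Φ_{l∖q}` and the
  pair-removed seas are orthogonal.
* `re_expect_onsitePairNumber_pairedState` — `Re⟨Φ_l, P_sᴴP_s Φ_l⟩ = 2|l|`.
* `exists_admissible_free_seq_onsitePairNumber_eq` — for every `δ ∈ (0,1/2)` an admissible sequence of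
  normalised FREE sector ground states (all sides `L`, filling `N_L = 2⌊(1-δ)L²/2⌋`) with `S_L = N_L` for
  every `L ≥ 3`.
* `not_onsitePairNumber_littleO_sq_at_zero_coupling` — hence the strengthening of the crux by
  (`0 ≤ U` and rate `S_L/L² → 0`) is FALSE: no rate better than `L²` can be asked of every ground state at
  the closure of the coupling range; the crux's `o(L⁴)` and the line's `O(L^{8/3})` (engine p146717) sit
  strictly between the free value `L²` and the trivial `L⁴`. (The matrix `S_L/L⁴ → 0` itself still holds at
  `U = 0` — `S_L ≤ N_L + O(L²)` on free shells — so the sign hypothesis `0 < U` excludes only `U < 0`.)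

Sources: C. N. Yang, Rev. Mod. Phys. **34** (1962) 694, §3 (`ρ₂` of a Slater determinant: no ODLRO, the
largest pair eigenvalue is `O(1)` and the `k = 0` pair occupation is `O(N)`); J. Bardeen, L. N. Cooper,
J. R. Schrieffer, Phys. Rev. **108** (1957) 1175, §II; J. von Delft, D. C. Ralph, Phys. Rep. **345** (2001) 61,
§4.2. Elementary on the tree's paired-product-state algebra; no definition is introduced.
-/

noncomputable section

set_option linter.dupNamespace false

namespace Summit.HubbardSuperconductivity.HubbardSuperconductivity.Theorems.NoOnsiteODLRO.Negative

open Matrix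
open Literature.Probability.LatticeModels Literature.MathematicalPhysics.QuantumLattice
open scoped ComplexOrder

section FixedSide

variable {L : ℕ} [NeZero L]

/-- The fully paired product vector `Φ_l = Π_{k ∈ l} b†_k |0⟩` (local notation for the literal term). -/
local notation "Φ[" l "]" =>
  (List.prod (List.map (fun k : TorusSite 2 _ => (pairMode k)ᴴ) l) *ᵥ
    (vacuum : Fock (Orb (FermionTorus 2 _))))

/-- **The `s`-wave profile is flat**: `pairFieldMode sWave L k = √2` for every Bloch momentum `k`
(only the on-site term `e = 0` of the form factor survives, and `χ_k(0) = 1`). [folklore] -/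
theorem pairFieldMode_sWave (k : TorusSite 2 L) : pairFieldMode sWave L k = Real.sqrt 2 := by
  unfold pairFieldMode
  rw [Finset.sum_insert zero_not_mem_unitSteps]
  have hrest : ∑ e ∈ unitSteps, sWave e * (torusChar k (Torus.proj L e)).re = 0 := by
    refine Finset.sum_eq_zero fun e he => ?_
    have h0 : sWave e = 0 := by
      unfold sWave
      rw [if_neg]
      exact fun h => zero_not_mem_unitSteps (h ▸ he)
    rw [h0, zero_mul]
  have hproj : Torus.proj L (0 : Site 2) = 0 := by
    funext i
    simp [Torus.proj]
  rw [hrest, add_zero, hproj, torusChar_zero_right]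
  simp [sWave]

/-- **The on-site pair field in Bloch modes**: `P_s = pairField sWave L = -√2 Σ_k b_k`,
`b_k = c_{-k↓} c_{k↑}` — the `s`-wave (`ĝ ≡ 1`) reduced-BCS pair operator.
Bardeen–Cooper–Schrieffer (1957) §II; von Delft–Ralph (2001) §4.2.1. [folklore] -/
theorem pairField_sWave_eq_neg_smul_sum_pairMode :
    pairField sWave L = -(((Real.sqrt 2 : ℝ) : ℂ) • ∑ k : TorusSite 2 L, pairMode k) := by
  rw [pairField_eq_neg_sum_pairFieldMode_smul_pairMode, Finset.smul_sum]
  congr 1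
  exact Finset.sum_congr rfl fun k _ => by rw [pairFieldMode_sWave]

/-- `b_q Φ_l = Φ_{l ∖ q}` for `q ∈ l` (duplicate-free `l`). [folklore] -/
theorem pairMode_pairedState_of_mem {l : List (TorusSite 2 L)} (hl : l.Nodup) {q : TorusSite 2 L}
    (hq : q ∈ l) : pairMode q *ᵥ Φ[l] = Φ[l.erase q] := by
  rw [pairedState_eq_of_mem hq, pairMode_pairMode_conjTranspose_pairedState_of_not_mem (hl.not_mem_erase)]

/-- Pair-removed seas over different removed momenta are orthogonal:
`⟨Φ_{l∖q}, Φ_{l∖q'}⟩ = 0` for `q ≠ q'` in a duplicate-free `l` (`n_{q'↑}` separates them). [folklore] -/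
theorem star_pairedState_erase_dotProduct_erase {l : List (TorusSite 2 L)} (hl : l.Nodup)
    {q q' : TorusSite 2 L} (hq' : q' ∈ l) (hne : q ≠ q') :
    star Φ[l.erase q] ⬝ᵥ Φ[l.erase q'] = 0 := by
  have h1 : q' ∈ l.erase q := (List.mem_erase_of_ne (Ne.symm hne)).2 hq'
  have h2 : q' ∉ l.erase q' := hl.not_mem_erase
  calc star Φ[l.erase q] ⬝ᵥ Φ[l.erase q']
      = star (momentumNumber q' 0 *ᵥ Φ[l.erase q]) ⬝ᵥ Φ[l.erase q'] := by
          rw [momentumNumber_up_pairedState_of_mem h1]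
    _ = star Φ[l.erase q] ⬝ᵥ ((momentumNumber q' 0)ᴴ *ᵥ Φ[l.erase q']) := by
          rw [star_mulVec, ← dotProduct_mulVec]
    _ = 0 := by
          rw [momentumNumber_conjTranspose, momentumNumber_up_pairedState_of_not_mem h2, dotProduct_zero]

/-- **On-site pair structure factor of a paired Fermi sea**: for a duplicate-free list `l` of momenta,
`Re⟨Φ_l, P_sᴴ P_s Φ_l⟩ = 2|l|` — every pair `(k↑, -k↓)` of the sea is an on-site `k = 0` Cooper pair
of amplitude `√2`, and the pair-removed seas are orthonormal. So the FREE ground states saturate the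
`L²` law: `S_L = N_L` exactly. Yang, Rev. Mod. Phys. 34 (1962) 694, §3; BCS (1957) §II. [folklore] -/
theorem re_expect_onsitePairNumber_pairedState {l : List (TorusSite 2 L)} (hl : l.Nodup) :
    (expect ((pairField sWave L)ᴴ * pairField sWave L) Φ[l]).re = 2 * (l.length : ℝ) := by
  classical
  -- `P_s Φ_l = -√2 Σ_{k ∈ l} Φ_{l ∖ k}`
  have hP : pairField sWave L *ᵥ Φ[l] =
      -(((Real.sqrt 2 : ℝ) : ℂ) • ∑ k ∈ l.toFinset, Φ[l.erase k]) := by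
    rw [pairField_sWave_eq_neg_smul_sum_pairMode, neg_mulVec, smul_mulVec, sum_mulVec]
    congr 2
    rw [← Finset.sum_subset (Finset.subset_univ l.toFinset)
      (fun k _ hk => pairMode_pairedState_of_not_mem (by simpa using hk))]
    exact Finset.sum_congr rfl fun k hk => pairMode_pairedState_of_mem hl (by simpa using hk)
  -- the Gram sum of the pair-removed seas is `|l|`
  have hgram : star (∑ k ∈ l.toFinset, Φ[l.erase k]) ⬝ᵥ (∑ k ∈ l.toFinset, Φ[l.erase k]) =
      (l.length : ℂ) := by
    rw [star_sum, sum_dotProduct]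
    have hdiag : ∀ k ∈ l.toFinset, star Φ[l.erase k] ⬝ᵥ (∑ k' ∈ l.toFinset, Φ[l.erase k']) = 1 := by
      intro k hk
      rw [dotProduct_sum, Finset.sum_eq_single k]
      · exact star_pairedState_dotProduct_self (hl.erase k)
      · intro k' hk' hk'k
        exact star_pairedState_erase_dotProduct_erase hl (by simpa using hk') (Ne.symm hk'k)
      · exact fun h => (h hk).elim
    rw [Finset.sum_congr rfl hdiag, Finset.sum_const, nsmul_eq_mul, mul_one, List.card_toFinset,
      List.Nodup.dedup hl]
  unfold expect
  rw [← mulVec_mulVec, dotProduct_mulVec, ← star_mulVec, hP, star_neg, neg_dotProduct, dotProduct_neg,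
    neg_neg, star_smul, smul_dotProduct, dotProduct_smul, hgram, smul_smul, Complex.star_def,
    Complex.conj_ofReal, ← Complex.ofReal_mul, Real.mul_self_sqrt zero_le_two, smul_eq_mul]
  norm_num

end FixedSide

/-! ### Along the admissible sequences: the `L²` law is attained at `U = 0` -/

/-- The admissible pair number never exceeds the number of Bloch momenta: `⌊(1-δ)L²/2⌋ ≤ L²` for
`0 ≤ δ`. [folklore] -/
theorem floor_filling_le_sq {δ : ℝ} (hδ : 0 ≤ δ) (L : ℕ) : ⌊(1 - δ) * (L : ℝ) ^ 2 / 2⌋₊ ≤ L ^ 2 := by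
  have hL2 : (0 : ℝ) ≤ (L : ℝ) ^ 2 := by positivity
  have h : (1 - δ) * (L : ℝ) ^ 2 / 2 ≤ (L : ℝ) ^ 2 := by nlinarith
  calc ⌊(1 - δ) * (L : ℝ) ^ 2 / 2⌋₊ ≤ ⌊((L ^ 2 : ℕ) : ℝ)⌋₊ := Nat.floor_le_floor (by push_cast; exact h)
    _ = L ^ 2 := Nat.floor_natCast _

/-- **TIGHTNESS AT THE ENDPOINT `U = 0` (the `L²` law is attained by exact ground states).** For every
`δ ∈ (0, 1/2)` there is an admissible sequence for the FREE torus `hubbardTorus 2 L 1 0` — normalised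
ground states of the joint sectors `(N_L, S^z = 0)`, `N_L = 2⌊(1-δ)L²/2⌋`, at every side `L` — whose
on-site pair structure factor is EXACTLY the particle number, `Re⟨ψ_L, P_sᴴ P_s ψ_L⟩ = N_L`, at every
`L ≥ 3` (paired Fermi seas `Φ_F = Π_{k∈F} c†_{k↑}c†_{-k↓}|0⟩` over Fermi sets `F` of `⌊(1-δ)L²/2⌋` band
levels; `re_expect_onsitePairNumber_pairedState`). Consequences for the crux `NoOnsiteODLRO`: its
`o(L⁴)` conclusion cannot be sharpened to `o(L²)` at the closure of its coupling range, and the only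
content of the hypothesis `0 < U` at the endpoint is the exclusion of `U < 0` (the matrix `S_L/L⁴ → 0`
itself still holds at `U = 0`, where `S_L = N_L + O(L²)`). Yang, Rev. Mod. Phys. 34 (1962) 694, §3;
Bardeen–Cooper–Schrieffer (1957) §II. [folklore] -/
theorem exists_admissible_free_seq_onsitePairNumber_eq {δ : ℝ} (hδ : δ ∈ Set.Ioo (0 : ℝ) (1 / 2)) :
    ∃ (N : ℕ → ℕ) (ψ : ∀ L, Fock (Orb (FermionTorus 2 L))),
      (∀ L, N L = 2 * ⌊(1 - δ) * (L : ℝ) ^ 2 / 2⌋₊ ∧ star (ψ L) ⬝ᵥ ψ L = 1 ∧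
          IsGroundStateInSector (hubbardTorus 2 L 1 0) (N L) 0 (ψ L)) ∧
        ∀ (L : ℕ) [NeZero L], 3 ≤ L →
          (expect ((pairField sWave L)ᴴ * pairField sWave L) (ψ L)).re = (N L : ℝ) := by
  classical
  -- the background sequence (used for the sides `L < 3` only)
  obtain ⟨N₀, ψ₀, h₀⟩ := Summit.HubbardSuperconductivity.NoGo.exists_groundStateInSector_seq 1 0 δ (by linarith [hδ.1])
  -- Fermi sets of `⌊(1-δ)L²/2⌋` levels at every side `L ≥ 1`
  have hF : ∀ (L : ℕ) [NeZero L], ∃ (F : Finset (TorusSite 2 L)) (eF : ℝ),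
      F.card = ⌊(1 - δ) * (L : ℝ) ^ 2 / 2⌋₊ ∧ (∀ k ∈ F, torusBand L k ≤ eF) ∧ (∀ k ∉ F, eF ≤ torusBand L k) := by
    intro L _
    refine exists_fermiSet (torusBand L) ?_
    rw [card_torusSite_two]
    exact floor_filling_le_sq hδ.1.le L
  -- choose them (a junk instance-free packaging: at `L = 0` we never use the choice)
  have hF' : ∀ L : ℕ, ∃ (F : Finset (TorusSite 2 L)) (eF : ℝ), L ≠ 0 →
      F.card = ⌊(1 - δ) * (L : ℝ) ^ 2 / 2⌋₊ ∧ (∀ k ∈ F, @torusBand 2 L k ≤ eF) ∧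
        (∀ k ∉ F, eF ≤ @torusBand 2 L k) := by
    intro L
    by_cases hL : L = 0
    · exact ⟨∅, 0, fun h => (h hL).elim⟩
    · haveI : NeZero L := ⟨hL⟩
      obtain ⟨F, eF, h⟩ := hF L
      exact ⟨F, eF, fun _ => h⟩
  choose F eF hFspec using hF'
  refine ⟨fun L => 2 * ⌊(1 - δ) * (L : ℝ) ^ 2 / 2⌋₊,
    fun L => if h : 3 ≤ L then
      (List.prod (List.map (fun k : TorusSite 2 L => (@pairMode 2 L ⟨by omega⟩ k)ᴴ) (F L).toList) *ᵥ
        (vacuum : Fock (Orb (FermionTorus 2 L))))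
      else ψ₀ L, fun L => ⟨rfl, ?_, ?_⟩, fun L _ hL => ?_⟩
  · by_cases hL : 3 ≤ L
    · haveI : NeZero L := ⟨by omega⟩
      simp only [dif_pos hL]
      exact star_pairedState_dotProduct_self (F L).nodup_toList
    · simp only [dif_neg hL]
      exact (h₀ L).2.1
  · by_cases hL : 3 ≤ L
    · haveI : NeZero L := ⟨by omega⟩
      obtain ⟨hcard, hle, hge⟩ := hFspec L (NeZero.ne L)
      simp only [dif_pos hL]
      have hGS := isGroundStateInSector_pairedState_free hL (F L) (eF L) hle hge
      rwa [hcard] at hGS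
    · simp only [dif_neg hL]
      exact (h₀ L).1 ▸ (h₀ L).2.2
  · obtain ⟨hcard, -, -⟩ := hFspec L (NeZero.ne L)
    simp only [dif_pos hL]
    rw [re_expect_onsitePairNumber_pairedState (F L).nodup_toList, Finset.length_toList, hcard]
    push_cast
    ring

/-- **No `o(L²)` version of the crux, even at its closed endpoint.** The strengthening of
`NoOnsiteODLRO` obtained by (i) admitting the endpoint `U = 0` and (ii) asking the rate `S_L / L² → 0`
instead of `S_L / L⁴ → 0` is FALSE: along the free paired-Fermi-sea sequence `S_L / L² = N_L / L² → 1 - δ`.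
(The crux's own rate `o(L⁴)` and the line's target `O(L^{8/3})` sit strictly between the free value `L²` and
the trivial `L⁴`.) Yang, Rev. Mod. Phys. 34 (1962) 694, §3. [folklore] -/
theorem not_onsitePairNumber_littleO_sq_at_zero_coupling :
    ¬ ∀ (U δ : ℝ), 0 ≤ U → δ ∈ Set.Ioo (0 : ℝ) (1 / 2) →
      ∀ (N : ℕ → ℕ) (ψ : ∀ L, Fock (Orb (FermionTorus 2 L))),
        (∀ L, Even L → N L = 2 * ⌊(1 - δ) * (L : ℝ) ^ 2 / 2⌋₊ ∧ star (ψ L) ⬝ᵥ ψ L = 1 ∧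
            IsGroundStateInSector (hubbardTorus 2 L 1 U) (N L) 0 (ψ L)) →
          ∀ ε : ℝ, 0 < ε → ∃ L₀ : ℕ, ∀ (L : ℕ) [NeZero L], Even L → L₀ ≤ L →
            (expect ((pairField sWave L)ᴴ * pairField sWave L) (ψ L)).re / (L : ℝ) ^ 2 ≤ ε := by
  intro h
  have hδ : (1 / 4 : ℝ) ∈ Set.Ioo (0 : ℝ) (1 / 2) := ⟨by norm_num, by norm_num⟩
  obtain ⟨N, ψ, hadm, hS⟩ := exists_admissible_free_seq_onsitePairNumber_eq hδ
  obtain ⟨L₀, hL₀⟩ := h 0 (1 / 4) le_rfl hδ N ψ (fun L _ => hadm L) (1 / 2) (by norm_num)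
  -- an even side `L ≥ max L₀ 4`
  set L : ℕ := 2 * (L₀ + 2) with hLdef
  haveI : NeZero L := ⟨by omega⟩
  have hE : Even L := even_two_mul _
  have h4 : 4 ≤ L := by omega
  have hbd := hL₀ L hE (by omega)
  rw [hS L (by omega), (hadm L).1] at hbd
  -- `N_L / L² ≤ 1/2` contradicts `N_L = 2⌊(3/4)L²/2⌋ ≥ (3/4)L² - 2` once `L ≥ 4`
  set x : ℕ := ⌊(1 - 1 / 4) * (L : ℝ) ^ 2 / 2⌋₊ with hx
  have hLpos : (0 : ℝ) < (L : ℝ) ^ 2 := by positivity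
  rw [div_le_iff₀ hLpos] at hbd
  push_cast at hbd
  have hfloor : (1 - 1 / 4 : ℝ) * (L : ℝ) ^ 2 / 2 - 1 ≤ (x : ℝ) := by
    have := Nat.lt_floor_add_one ((1 - 1 / 4) * (L : ℝ) ^ 2 / 2)
    rw [← hx] at this
    linarith
  have hL4 : (4 : ℝ) ≤ (L : ℝ) := by exact_mod_cast h4
  have h16 : (16 : ℝ) ≤ (L : ℝ) ^ 2 := by nlinarith
  linarith

end Summit.HubbardSuperconductivity.HubbardSuperconductivity.Theorems.NoOnsiteODLRO.Negative

end
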